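import Mathlib

/-!
# `Balaban1983to89.B16MultiscaleCount` — the multiscale count behind B16 p. 372 "for a given Y₀ we obtain a term which is small"

CITATION HEADER (lean-in-tree rule 2026-08-18).  Reproduced: the COUNTING half of one by-reference sentence of a published
paper under adjudication by the audit cell `pub-balaban` (cell paper B16 = T. Bałaban, *Large field renormalization. II.
Localization, exponentiation, and bounds for the 𝐑 operation*, Commun. Math. Phys. **122**, 355–392 (1989),
doi:10.1007/bf01238433 [Balaban1989LargeFieldII]; GAPS row G-adv3-12, adversarial reader 3, gen 7).  Printed, p. 372
[PDF 18] verbatim: *"Consider a term 𝐄^{(j)}(X,U″_k,z) with X ⊂ Z^c, and let z ∈ Ω_n∖Ω_{n+1} for n ≧ j. As in Sect. 3 we take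
the cube □ ∈ π_n containing the point z, and we consider the case X ⊂ □^{~2}. … where □₀ = □^{~5} (the operation ~ is defined
here in terms of M-cubes of the L^{−n}-lattice). To the expression in the square bracket above we apply all the
transformations and estimates of Sects. 3–5 [I] (with η replaced by L^{−n}). … The nonvanishing terms in the expansion can
be estimated as in (6.24)–(6.29) [I] … In effect, for a given Y₀ we obtain a term which is small, and satisfies the
exponential bound (2.42) [III] in d_k(Y₀)."*  Here "(6.24)–(6.29) [I]" = B13 (1.24)–(1.29) (cell DIVERGENCE D-T1/D-T1c:
[I] §6 = CMP 116 §1), [III] = B14 (CMP 119).  Nothing of the series is asserted; the manuscript is not cited for the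
disputed step.

WHAT IS CHECKED (finite sums of reals; no analysis):
* `family_card` — at a fixed final domain Y₀ the resummed family is indexed by scales j ≤ n ≤ k, scale-n cubes □ with
  □₀ ⊂ Y₀, scale-j sites z ∈ □ (and X ∋ z, paid separately by B13 (1.26)); with V = M⁻⁴|Y₀| scale-k M-cubes there are
  `L^{4(k−n)}·V` cubes □ and `(M·L^{n−j})^4` sites z per cube, i.e. `M^4·L^{4(k−j)}·V` pairs (□,z) per (j,n) — pure algebra;
* `count_paid` — a per-term factor `r^{m}`, `m = k − j`, with `0 ≤ r < 1` pays the scale sum: `Σ_{m≤k} (m+1)·r^{m} ≤ (1−r)⁻²`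
  uniformly in k.  Instances: `count_paid_order5` (B12 (3.35)/(3.54), B13 (1.24): the fifth-order remainder carries
  `(L^jη)^5 = L^{−5(k−j)}`, against the count `L^{4(k−j)}`: r = L⁻¹), `count_paid_irrelevant` (B12 (4.29): exponent 4+β,
  r = L^{−β}, β > 0);
* `count_unpaid_marginal` / `count_unpaid_relevant` — a per-term factor `(L^jη)^m` with m ≤ 4 does NOT pay it: the scale
  sum is ≥ k+1 (m = 4, marginal) resp. ≥ L^{(4−m)k} (m ≤ 3), unbounded in k.  These orders are exactly the ones [I] §§4–5
  treat by the Ward identities, the moment expansion and the β_j-counterterm — the "renormalization procedure for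
  𝐄-terms" p. 372 invokes by name and does not display for the Λ-supported, □₀-localized, Y₀-resummed bracket (GAPS
  G-adv3-12 (c)).
-/

namespace Literature.MathematicalPhysics.QuantumFieldTheory.Balaban1983to89.B16.MultiscaleCount

open Finset

/-- `family_card`: the number of (cube, site) pairs at scales (j, n), j ≤ n ≤ k, for a domain of `V` scale-k M-cubes,
`L, M : ℕ`: `(L^(4(k−n)) * V) * (M * L^(n−j))^4 = M^4 * L^(4(k−j)) * V`. [cite: Balaban1989LargeFieldII, p.372 (1.59)–(1.60) (cubes □ ∈ π_n, □₀ = □~5); Balaban1988RG2Cluster, (1.28) p.7] -/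
theorem family_card (L M V : ℕ) {j n k : ℕ} (hjn : j ≤ n) (hnk : n ≤ k) :
    (L ^ (4 * (k - n)) * V) * (M * L ^ (n - j)) ^ 4 = M ^ 4 * L ^ (4 * (k - j)) * V := by
  have h : 4 * (k - j) = 4 * (k - n) + 4 * (n - j) := by omega
  rw [h, pow_add, mul_pow, ← pow_mul]
  ring

/-- `count_paid`: with `m = k − j`, `Σ_{m ≤ k} (m + 1) r^m ≤ (1 − r)⁻²` for `0 ≤ r < 1`, uniformly in `k`. [cite: Balaban1988RG2Cluster, (1.26)–(1.29) pp.7–8 (one-scale version)] -/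
theorem count_paid {r : ℝ} (h0 : 0 ≤ r) (h1 : r < 1) (k : ℕ) :
    ∑ m ∈ range (k + 1), ((m : ℝ) + 1) * r ^ m ≤ (1 - r)⁻¹ ^ 2 := by
  have hn : ‖r‖ < 1 := by rw [Real.norm_eq_abs, abs_of_nonneg h0]; exact h1
  have h1' : Summable (fun m : ℕ => (m : ℝ) * r ^ m) := by
    simpa using summable_pow_mul_geometric_of_norm_lt_one 1 hn
  have h2' : Summable (fun m : ℕ => r ^ m) := summable_geometric_of_lt_one h0 h1
  have hsum : Summable (fun m : ℕ => ((m : ℝ) + 1) * r ^ m) := by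
    simpa [add_mul] using h1'.add h2'
  calc ∑ m ∈ range (k + 1), ((m : ℝ) + 1) * r ^ m
      ≤ ∑' m : ℕ, ((m : ℝ) + 1) * r ^ m :=
        hsum.sum_le_tsum _ (fun m _ => by positivity)
    _ = ∑' m : ℕ, (m : ℝ) * r ^ m + ∑' m : ℕ, r ^ m := by
        rw [← h1'.tsum_add h2']
        congr 1; ext m; ring
    _ = r / (1 - r) ^ 2 + (1 - r)⁻¹ := by
        rw [tsum_coe_mul_geometric_of_norm_lt_one hn, tsum_geometric_of_lt_one h0 h1]
    _ = (1 - r)⁻¹ ^ 2 := by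
        have hpos : (1 - r) ≠ 0 := by linarith
        field_simp
        ring

/-- Fifth-order remainder (B12 (3.54), B13 (1.24)): count `L^{4m}` against `(L^jη)^5 = L^{−5m}`, `m = k − j`,
`L^kη = 1`: the scale sum is bounded by `(1 − L⁻¹)⁻²`. [cite: Balaban1987RG1, (3.54) p.280; Balaban1988RG2Cluster, (1.24) p.7] -/
theorem count_paid_order5 {L : ℝ} (hL : 1 < L) (k : ℕ) :
    ∑ m ∈ range (k + 1), ((m : ℝ) + 1) * (L ^ (4 * m) * (L⁻¹ ^ m) ^ 5) ≤ (1 - L⁻¹)⁻¹ ^ 2 := by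
  have h0 : 0 ≤ L⁻¹ := by positivity
  have h1 : L⁻¹ < 1 := inv_lt_one_of_one_lt₀ hL
  have hL0 : L ≠ 0 := by positivity
  calc ∑ m ∈ range (k + 1), ((m : ℝ) + 1) * (L ^ (4 * m) * (L⁻¹ ^ m) ^ 5)
      = ∑ m ∈ range (k + 1), ((m : ℝ) + 1) * L⁻¹ ^ m := by
        apply Finset.sum_congr rfl
        intro m _
        congr 1
        rw [← pow_mul, inv_pow, inv_pow, show m * 5 = 4 * m + m by ring, pow_add]
        field_simp
    _ ≤ (1 - L⁻¹)⁻¹ ^ 2 := count_paid h0 h1 k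

/-- Irrelevant terms with exponent `4 + β` (B12 (4.29)): `r = L^{−β}`, `β > 0`. [cite: Balaban1987RG1, (4.29) p.287] -/
theorem count_paid_irrelevant {L β : ℝ} (hL : 1 < L) (hβ : 0 < β) (k : ℕ) :
    ∑ m ∈ range (k + 1), ((m : ℝ) + 1) * (L ^ (-β)) ^ m ≤ (1 - L ^ (-β))⁻¹ ^ 2 := by
  have h0 : 0 ≤ L ^ (-β) := by positivity
  have h1 : L ^ (-β) < 1 := by
    rw [Real.rpow_neg (by linarith)]
    exact inv_lt_one_of_one_lt₀ (Real.one_lt_rpow hL hβ)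
  exact count_paid h0 h1 k

/-- Marginal order (4): the scale sum `Σ_{m≤k} (m+1)·L^{4m}·(L^{−m})^4 = Σ (m+1) ≥ k + 1`, unbounded in `k` — the marginal order, treated in print only by the β_j-counterterm. [cite: Balaban1987RG1, (4.38)–(4.45) and (5.42)–(5.43) pp.289–298] -/
theorem count_unpaid_marginal {L : ℝ} (hL : 0 < L) (k : ℕ) :
    (k : ℝ) + 1 ≤ ∑ m ∈ range (k + 1), ((m : ℝ) + 1) * (L ^ (4 * m) * (L⁻¹ ^ m) ^ 4) := by
  have hL0 : L ≠ 0 := by positivity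
  have hre : ∀ m ∈ range (k + 1),
      ((m : ℝ) + 1) * (L ^ (4 * m) * (L⁻¹ ^ m) ^ 4) = ((m : ℝ) + 1) := by
    intro m _
    rw [← pow_mul, inv_pow, show m * 4 = 4 * m by ring]
    field_simp
  rw [Finset.sum_congr rfl hre]
  calc (k : ℝ) + 1 = ∑ m ∈ range (k + 1), (1 : ℝ) := by simp
    _ ≤ ∑ m ∈ range (k + 1), ((m : ℝ) + 1) :=
        Finset.sum_le_sum (fun m _ => by linarith [(Nat.cast_nonneg m : (0:ℝ) ≤ m)])

/-- Relevant orders (`e ≤ 3`): the `m = k` term alone is `(k+1)·L^{(4−e)k} ≥ L^{(4−e)k}`, unbounded in `k` for `L > 1` — orders removed in print by the Ward identities. [cite: Balaban1987RG1, (4.9)–(4.15) pp.283–285] -/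
theorem count_unpaid_relevant {L : ℝ} (hL : 1 < L) {e : ℕ} (he : e ≤ 3) (k : ℕ) :
    L ^ ((4 - e) * k) ≤ ∑ m ∈ range (k + 1), ((m : ℝ) + 1) * (L ^ (4 * m) * (L⁻¹ ^ m) ^ e) := by
  have hL0 : 0 < L := by linarith
  have hL0' : L ≠ 0 := by positivity
  have hterm : ∀ m ∈ range (k + 1),
      0 ≤ ((m : ℝ) + 1) * (L ^ (4 * m) * (L⁻¹ ^ m) ^ e) := fun m _ => by positivity
  have hk : k ∈ range (k + 1) := by simp
  have hval : L ^ (4 * k) * (L⁻¹ ^ k) ^ e = L ^ ((4 - e) * k) := by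
    rw [← pow_mul, inv_pow, show 4 * k = (4 - e) * k + k * e by
      have : 4 - e + e = 4 := by omega
      calc 4 * k = (4 - e + e) * k := by rw [this]
        _ = (4 - e) * k + k * e := by ring, pow_add]
    field_simp
  calc L ^ ((4 - e) * k)
      ≤ ((k : ℝ) + 1) * (L ^ (4 * k) * (L⁻¹ ^ k) ^ e) := by
        rw [hval]
        have : (1 : ℝ) ≤ (k : ℝ) + 1 := by linarith [(Nat.cast_nonneg k : (0:ℝ) ≤ k)]
        nlinarith [pow_pos hL0 ((4 - e) * k)]
    _ ≤ ∑ m ∈ range (k + 1), ((m : ℝ) + 1) * (L ^ (4 * m) * (L⁻¹ ^ m) ^ e) :=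
        Finset.single_le_sum hterm hk

end Literature.MathematicalPhysics.QuantumFieldTheory.Balaban1983to89.B16.MultiscaleCount
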